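import Literature.AnabelianGeometry.EtaleTheta.Discharge.Sec4CyclotomicLawBaseFieldHull
import Literature.AnabelianGeometry.EtaleTheta.TemperedFrobenioidOfBaseFieldHullSetting
import HarnessLib

/-!
# [EtTh] Prop. 4.2 (iii) for the §1 SETTING at its base-field-theoretic hull over `B^temp(Π^tp_X̲̲)⁰` (`A_⊙^bs := Ÿ̲̲`): N-th-root
# objects EXIST in the genuine-constants carrier of the §5 construction — PROOF-ONLY

S. Mochizuki, *The étale theta function and its Frobenioid-theoretic manifestations*, Publ. RIMS **45** (2009) [MochizukiEtTh2009],
Prop. 4.2 (iii) pp.314–315 (PDF pp.88–89); §5 p.322 (PDF p.96) («we return to the situation of §1 … a tempered Frobenioid of monoid type `ℤ`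
over the base `D := B^temp(Π^tp_X̲̲)⁰` … geometrically connected over `K = K̈`»).
[cite: MochizukiEtTh2009, Prop 4.2 (iii) p.314 (PDF p.88); §5 p.322 (PDF p.96)]

abc-iut cell, layer L2, seat abc-iut-L2-d3 (gen 10), row R1112 junction (c) at the §5 setting.  PROOF-ONLY (0 definitions, no instance,
no notation, no sorry): the augmentation `a := (Π^tp_X̲̲ ⊆ Π^tp_X ↠ G_K ≤ G_{ℚ_p})` of the Setting (`augHuu`, p506618) is CONTINUOUS, so
this lineage's generic `BsFldHull.prop42_iii_mkOfConnectedTemperoid_trivNH` (`Discharge/Sec4CyclotomicLawBaseFieldHull.lean`) applies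
to abc-iut-L2-t4's §4/§5 setting OF THE SETTING at the hull, `hullSetting C e R S μ hC hS NH` (p506618; `A_⊙ := (Π^tp_X̲̲/Π^tp_Ÿ̲̲, 0)`,
definitionally `mkOfThetaSettingYdd = mkOfConnectedTemperoidYdd = mkOfConnectedTemperoid … (connQuotZeroObj _) …`), with the
trivial `(N,H)`-slot: **[EtTh] Prop. 4.2 (iii) AS TYPED holds there — every binder a theorem** (the remaining inputs of the §5 chain at
this carrier are the `l`-th root datum of `Θ̈`'s fraction pair and the Def. 5.4 `(N,H)`-slot for (iv)/`roots_of_K`).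
HONEST FRAMING: a kernel-checked property of OUR typed §4 predicate at a carrier with genuine `ℚ̄_p` constants and degenerate divisor
geometry; nothing asserts that this carrier is print's tempered Frobenioid of a curve; nothing here bears on [IUTchIII] Cor. 3.12; no side
taken; typed ≠ proved elsewhere.
-/

noncomputable section

namespace Literature.AnabelianGeometry.EtaleTheta

open CategoryTheory Opposite Literature.AlgebraicGeometry.Frobenioids Literature.AnabelianGeometry.SemiGraphs

namespace ThetaSetting.EtaleThetaData.DoubleUnderline

variable {p : ℕ} [Fact p.Prime] {D : ThetaSetting p} {E : D.EtaleThetaData} {l : ℕ} (C : E.DoubleUnderline l)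

/-- **The augmentation `Π^tp_X̲̲ → G_{ℚ_p}` is continuous** (`Π^tp_X ↠ G_K` is a continuous homomorphism, `Π^tp_X̲̲ ⊆ Π^tp_X` has the
subspace topology).  [cite: MochizukiEtTh2009, §5 p.322 (PDF p.96)] -/
theorem continuous_augHuu : Continuous C.augHuu := (map_continuous D.aug).comp continuous_subtype_val

variable (e : D.toTemperedCurve.GroupLevelData) (R S : ((ConnectedPart (BTemp (C.temperedArithmeticGroup e).Pi))ᵒᵖ ⥤ CommMonCat.{0}) → Prop)
  {N : ℕ+} (μ : D.CyclotomeMod l N) (hC : D.Compat) (hS : D.Sec2Hyps)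

/-- **[EtTh] Prop. 4.2 (iii) AS TYPED for the §4/§5 setting OF THE SETTING at the base-field-theoretic hull over `B^temp(Π^tp_X̲̲)⁰`**
(`A_⊙^bs := Ÿ̲̲`, trivial `(N,H)`-slot): every pre-root-Frobenius-trivial Galois-based object is dominated by a pull-back morphism from a
`μ_M`-saturated Galois-based one — N-th-root objects EXIST in the hull of the Setting.  This lineage's
`BsFldHull.prop42_iii_mkOfConnectedTemperoid_trivNH` at `a := augHuu C` (continuous, open images by the open mapping theorem).
[cite: MochizukiEtTh2009, Prop 4.2 (iii) p.314 (PDF p.88); §5 p.322 (PDF p.96)] -/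
theorem prop42_iii_hullSetting_trivNH :
    (C.hullSetting e R S μ hC hS (fun _ _ _ => True)).Prop42_iii (fun {_ _} φ x => (C.hullFrd e R S).pullFracModel φ x) :=
  BsFldHull.prop42_iii_mkOfConnectedTemperoid_trivNH p (C.temperedArithmeticGroup e) C.augHuu (C.isOpen_map_augHuu e) R S
    C.continuous_augHuu _ _ _

end ThetaSetting.EtaleThetaData.DoubleUnderline

end Literature.AnabelianGeometry.EtaleTheta

end
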